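import Summits.CriticalPhenomena.PercolationContinuityZ3.Theorems.Transplant.SkelPhiApronKitOK
import HarnessLib

/-!
# N1 (the `{±1}` node), LEVEL 1, kit adapter file N-K4e: THE PINNING SET OF THE APRON KIT AND THE AVOIDANCE OF ITS PAIRS — `Skelφ.pinSetA` (shell
# window ∪ the far inner neighbours NOT wired by a near kit), `face_subset_pinSetA`, **`seed_notMem_wireSet_pinSetA`** (the N1 replacements of
# `pinSet`, `slabSeedDeep_notMem_wireSet`)

builds on p205010 (kernel theorem, internal audit signed; external expert review pending) — nothing in this file uses p205010; nothing here is a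
claim about the open node `SamePDropOfSkeletonNeg`.
Lane `prim-bschramm`, seat `prim-bschramm-p1` (gen 11; design KIT-APRON-N1); helper file (`--supports stmt-CriticalPhenomena-4575 --as helper`).
WHY.  Under quasi-steps the first links of a near kit have inner vertices on the boundary layer (at the planar point of the inner neighbour), and
such a vertex may be the inner neighbour of a FAR contact; D″'s pinning set (shell ∪ ALL far inner neighbours) would then meet a wired region.
The cure is structural (KIT-APRON-N1): far contacts whose inner neighbour is wired by a near kit are ABSORBED into that kit (`apronGeomA`), and the
pinning set keeps only the far inner neighbours wired by nobody.  Avoidance is then by construction: every wired vertex is at depth `< D` (off the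
shell) and lies in `wiredAll` (off the far part).
* §1 `wiredAll`, **`pinSetA`**, `shellWinA_subset_pinSetA`, `pinSetA_subset_winLevel`, `not_mem_shellWinA_of_sdepth_lt`, `sdepth_le_of_mem_wireFinQ`,
  `not_mem_pinSetA_of_mem_ctReg`;
* §2 **`face_subset_pinSetA`**, **`seed_notMem_wireSet_pinSetA`**.
[cite: KozmaNitzan2024, §4 Lemma 10, p. 21 ("P_{K_ξ}(F_P) = P_G(F_P)", "Q ⊆ S"), pp. 21–22 (Step V)]
-/

noncomputable section

open scoped Classical

namespace Summit.CriticalPhenomena.PercolationContinuityZ3.Theorems.Transplant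

namespace Skelφ

open Literature.Probability.Percolation Literature.Probability.LatticeModels SimpleGraph KNLevels
open Literature.Probability.Percolation.KozmaNitzan.Cells (oth oth_ne eq_oth_of_ne oth_oth)
open Literature.Barriers.CriticalPhenomena (graphBall graphBall_finite mem_graphBall_self graphBall_mono)
open Skel (winGraph winGraph_adj KitGeom)
open SkelI (kitSeed mem_kitSeed_cases slabPt tanOff tanTgt tanTgt_mem)

variable {V : Type} [DecidableEq V] (G : SimpleGraph V) [G.LocallyFinite] {ψ φ : V → Site 2}

/-! ## §1 The pinning set -/

section Defs

variable {Lo Hi : Site 2} (SF : ∀ (i : Fin 2) (σ : ℤˣ), SideForm ψ φ Lo Hi i σ) (P : ApronPrm) (w₀ : V) (R : ℕ)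

/-- **All vertices wired by the near kits** of the contact set `K`. [this work] -/
def wiredAll (K : Finset V) : Finset V := (K.filter fun x => IsNear G ψ Lo Hi P w₀ R x).biUnion (ctReg G SF P w₀ R)

/-- **The pinning set of the apron kit**: the shell window together with the inner neighbours of the far contacts that are wired by no near kit.
[cite: KozmaNitzan2024, §4 p. 21 ("Q ⊆ S")] -/
def pinSetA (K : Finset V) : Finset V :=
  shellWinA G ψ w₀ R Lo Hi P.ℓs ∪
    (((K.filter fun x => ¬ IsNear G ψ Lo Hi P w₀ R x).image (ctY G ψ w₀ R Lo Hi)) \ wiredAll G SF P w₀ R K)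

/-- The shell window lies in the pinning set. [folklore] -/
theorem shellWinA_subset_pinSetA (K : Finset V) : shellWinA G ψ w₀ R Lo Hi P.ℓs ⊆ pinSetA G SF P w₀ R K := Finset.subset_union_left

end Defs

section Facts

variable {G} {w₀ : V} {R : ℕ}

omit [DecidableEq V] in
/-- A vertex at depth `< D` behind some side is off the shell window. [folklore] -/
theorem not_mem_shellWinA_of_sdepth_lt {Lo Hi : Site 2} {i₀ : Fin 2} {σ₀ : ℤˣ} {ℓs : ℕ} {v : V}
    (h : sdepth ψ Lo Hi i₀ σ₀ v < ((2 * ℓs + 2 : ℕ) : ℤ)) : v ∉ shellWinA G ψ w₀ R Lo Hi ℓs := by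
  intro hv
  unfold shellWinA at hv
  rw [mem_Win, Finset.mem_Icc] at hv
  have h1 := hv.2.1 i₀; have h2 := hv.2.2 i₀
  simp only [Pi.add_apply, Pi.sub_apply, Pi.natCast_apply] at h1 h2
  unfold sdepth at h
  split_ifs at h <;> push_cast at h h1 h2 <;> omega

omit [G.LocallyFinite] in
/-- **The wired path behind a face stays at depth `≤ 1 + d`.** [folklore] -/
theorem sdepth_le_of_mem_wireFinQ {Lo Hi : Site 2} {N : ℕ} (hq : QStepsN G ψ N) {ℓs M d : ℕ} {i₀ : Fin 2} {σ₀ : ℤˣ} (hw2 : Lo i₀ + 2 ≤ Hi i₀)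
    {y : V} (hy : ψ y ∈ Finset.Icc Lo Hi) (hface : (σ₀ = 1 ∧ ψ y i₀ = Hi i₀) ∨ (σ₀ = -1 ∧ ψ y i₀ = Lo i₀)) {v : V}
    (hv : v ∈ wireFinQ G ψ N Lo Hi ℓs M i₀ σ₀ y d) : sdepth ψ Lo Hi i₀ σ₀ v ≤ 1 + d := by
  -- `sdepth` only depends on the exit coordinate
  have key : ∀ u u' : V, ψ u = ψ u' → sdepth ψ Lo Hi i₀ σ₀ u = sdepth ψ Lo Hi i₀ σ₀ u' := fun u u' h => by unfold sdepth; rw [h]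
  rcases ψ_of_mem_wireFinQ hv with h | ⟨k, -, h⟩ | ⟨k, hk, h⟩
  · rw [key _ _ h]
    unfold sdepth
    rcases hface with ⟨hs, hc⟩ | ⟨hs, hc⟩ <;> subst hs <;> simp [hc] <;> positivity
  · rw [key _ _ h, key _ _ (show ψ (pathPtQ G ψ N Lo Hi ℓs M i₀ y k) = ψ (pathPtQ G ψ N Lo Hi ℓs M i₀ y k) from rfl)]
    -- the path sits at depth `1`: its exit coordinate is `slabPt`, that of `stemPt 0`
    have e : sdepth ψ Lo Hi i₀ σ₀ (pathPtQ G ψ N Lo Hi ℓs M i₀ y k) = sdepth ψ Lo Hi i₀ σ₀ (stemPtQ G ψ N Lo Hi ℓs M i₀ σ₀ y 0) := by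
      unfold sdepth
      rw [(ψ_pathPtQ hq i₀ hw2 hy k).1, (ψ_stemPtQ_coords hq (ℓs := ℓs) (M := M) i₀ hw2 σ₀ hy 0).1]; simp
    rw [e, sdepth_stemPtQ hq hw2 hy hface 0]; omega
  · rw [key _ _ h, sdepth_stemPtQ hq hw2 hy hface k]; omega

/-- **Wired regions of near contacts miss the pinning set** (`d + 2 ≤ D`; placement hypotheses). [this work] -/
theorem not_mem_pinSetA_of_mem_ctReg {Lo Hi : Site 2} (SF : ∀ (i : Fin 2) (σ : ℤˣ), SideForm ψ φ Lo Hi i σ) {P : ApronPrm}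
    (hlip : Lip G ψ) (hq : QStepsN G ψ P.N) (hstep : Steps G φ) (hw2 : ∀ i, Lo i + 2 ≤ Hi i) (hdD : P.d + 2 ≤ shellD P)
    (hbelow : ∀ (i : Fin 2) (σ : ℤˣ) (z : Site 2), (SF i σ).lin z < (SF i σ).θ (2 + P.d) → ∀ m : ℤ, -(P.W : ℤ) ≤ m → m ≤ P.W →
      (SF i σ).lin (apronPt z (SF i σ).a (SF i σ).s m 0) + P.ℓ * (SF i σ).UL < (SF i σ).θ (shellD P))
    (habove : ∀ (i : Fin 2) (σ : ℤˣ) (z : Site 2), (SF i σ).θ (1 + P.d) ≤ (SF i σ).lin z → ∀ m : ℤ, -(P.W : ℤ) ≤ m → m ≤ P.W →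
      (SF i σ).θ 1 ≤ (SF i σ).lin (apronPt z (SF i σ).a (SF i σ).s m 0) - P.ℓ * (SF i σ).UL)
    {K : Finset V} {x₀ : V} (hx₀K : x₀ ∈ K) (hx₀ : x₀ ∈ outerBoundary (winGraph G w₀ R) (Win G ψ w₀ (Finset.Icc Lo Hi) R))
    (hnear : IsNear G ψ Lo Hi P w₀ R x₀) {v : V} (hv : v ∈ ctReg G SF P w₀ R x₀) : v ∉ pinSetA G SF P w₀ R K := by
  intro hvS
  unfold pinSetA at hvS
  rcases Finset.mem_union.1 hvS with h | h
  · -- off the shell: depth `< D`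
    refine not_mem_shellWinA_of_sdepth_lt (i₀ := (ctDir G ψ w₀ R Lo Hi x₀).1) (σ₀ := (ctDir G ψ w₀ R Lo Hi x₀).2) ?_ h
    unfold ctReg at hv
    rcases Finset.mem_union.1 hv with hw | ha
    · unfold ctWire at hw
      have := sdepth_le_of_mem_wireFinQ hq (hw2 _) (ctY_mem_Icc hx₀) (ctDir_face hlip hx₀) hw
      unfold shellD at hdD; push_cast; omega
    · have := (apron_sdepth SF hlip hq hstep hw2 hbelow habove hx₀ ha).2
      unfold shellD at this; exact_mod_cast this
  · -- in `wiredAll`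
    rw [Finset.mem_sdiff] at h
    refine h.2 ?_
    unfold wiredAll
    exact Finset.mem_biUnion.2 ⟨x₀, Finset.mem_filter.2 ⟨hx₀K, hnear⟩, hv⟩

/-- **The pinning set lies in the window level** (`Lo = lo − j`, `Hi = hi + j`, `K` the contact set). [folklore] -/
theorem pinSetA_subset_winLevel {lo hi : Site 2} {j : ℕ} (SF : ∀ (i : Fin 2) (σ : ℤˣ), SideForm ψ φ (lo - (j : Site 2)) (hi + (j : Site 2)) i σ)
    (P : ApronPrm) :
    pinSetA G SF P w₀ R (outerBoundary (winGraph G w₀ R) (winLevel G ψ w₀ R lo hi j)) ⊆ winLevel G ψ w₀ R lo hi j := by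
  intro v hv
  unfold pinSetA at hv
  rcases Finset.mem_union.1 hv with h | h
  · unfold shellWinA at h
    rw [mem_Win] at h
    unfold winLevel; rw [mem_Win]
    refine ⟨h.1, ?_⟩
    have h2 := h.2
    rw [Finset.mem_Icc] at h2 ⊢
    constructor <;> intro i
    · have := h2.1 i; simp only [Pi.add_apply, Pi.natCast_apply] at this; push_cast at this; linarith
    · have := h2.2 i; simp only [Pi.sub_apply, Pi.natCast_apply] at this; push_cast at this; linarith
  · rw [Finset.mem_sdiff, Finset.mem_image] at h
    obtain ⟨x, hx, rfl⟩ := h.1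
    have hxK := (Finset.mem_filter.1 hx).1
    unfold ctY winLevel
    exact inNbr_mem_Win hxK

/-! ## §2 Faces in the pinning set; seeds off its pairs -/

/-- **Every face lies in the pinning set.** [cite: KozmaNitzan2024, §4 p. 21 ("Q ⊆ S")] -/
theorem face_subset_pinSetA {Lo Hi : Site 2} (SF : ∀ (i : Fin 2) (σ : ℤˣ), SideForm ψ φ Lo Hi i σ) (Rg : V → Finset V) (P : ApronPrm)
    {K : Finset V} {x : V} (hx : x ∈ K) : (apronGeomA G SF Rg P w₀ R K).U x ⊆ pinSetA G SF P w₀ R K := by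
  intro u hu
  simp only [apronGeomA] at hu
  split_ifs at hu with hnear habs
  · exact shellWinA_subset_pinSetA G SF P w₀ R K (ctQk_subset_shellWinA SF Rg (P := P) x (ctFace_subset_ctQk SF Rg x hu))
  · exact shellWinA_subset_pinSetA G SF P w₀ R K (ctQk_subset_shellWinA SF Rg (P := P) _ (ctFace_subset_ctQk SF Rg _ hu))
  · rw [Finset.mem_singleton] at hu; subst hu
    unfold pinSetA
    refine Finset.mem_union_right _ (Finset.mem_sdiff.2 ⟨Finset.mem_image.2 ⟨x, Finset.mem_filter.2 ⟨hx, hnear⟩, rfl⟩, fun hw => habs ?_⟩)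
    unfold wiredAll at hw
    obtain ⟨x₀, hx₀, hyx₀⟩ := Finset.mem_biUnion.1 hw
    obtain ⟨hx₀K, hx₀near⟩ := Finset.mem_filter.1 hx₀
    exact ⟨x₀, mem_hosts.2 ⟨hx₀K, hx₀near, hyx₀⟩⟩

/-- **No seed pair of the apron kit is a pair of the pinning set** (`d + 2 ≤ D`; placement hypotheses; `K` the contact set). [cite: KozmaNitzan2024, §4 p. 21] -/
theorem seed_notMem_wireSet_pinSetA {lo hi : Site 2} {j : ℕ}
    (SF : ∀ (i : Fin 2) (σ : ℤˣ), SideForm ψ φ (lo - (j : Site 2)) (hi + (j : Site 2)) i σ) (Rg : V → Finset V) {P : ApronPrm}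
    (hlip : Lip G ψ) (hq : QStepsN G ψ P.N) (hstep : Steps G φ) (hw2 : ∀ i, (lo - (j : Site 2)) i + 2 ≤ (hi + (j : Site 2)) i)
    (hdD : P.d + 2 ≤ shellD P)
    (hbelow : ∀ (i : Fin 2) (σ : ℤˣ) (z : Site 2), (SF i σ).lin z < (SF i σ).θ (2 + P.d) → ∀ m : ℤ, -(P.W : ℤ) ≤ m → m ≤ P.W →
      (SF i σ).lin (apronPt z (SF i σ).a (SF i σ).s m 0) + P.ℓ * (SF i σ).UL < (SF i σ).θ (shellD P))
    (habove : ∀ (i : Fin 2) (σ : ℤˣ) (z : Site 2), (SF i σ).θ (1 + P.d) ≤ (SF i σ).lin z → ∀ m : ℤ, -(P.W : ℤ) ≤ m → m ≤ P.W →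
      (SF i σ).θ 1 ≤ (SF i σ).lin (apronPt z (SF i σ).a (SF i σ).s m 0) - P.ℓ * (SF i σ).UL)
    {x : V} (hx : x ∈ outerBoundary (winGraph G w₀ R) (winLevel G ψ w₀ R lo hi j)) {e : Sym2 V}
    (he : e ∈ kitSeed G (apronGeomA G SF Rg P w₀ R (outerBoundary (winGraph G w₀ R) (winLevel G ψ w₀ R lo hi j))) x) :
    e ∉ wireSet (↑(pinSetA G SF P w₀ R (outerBoundary (winGraph G w₀ R) (winLevel G ψ w₀ R lo hi j))) : Set V) := by
  set K := outerBoundary (winGraph G w₀ R) (winLevel G ψ w₀ R lo hi j) with hK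
  have hKeq : winLevel G ψ w₀ R lo hi j = Win G ψ w₀ (Finset.Icc (lo - (j : Site 2)) (hi + (j : Site 2))) R := rfl
  have hx' : ∀ z ∈ K, z ∈ outerBoundary (winGraph G w₀ R) (Win G ψ w₀ (Finset.Icc (lo - (j : Site 2)) (hi + (j : Site 2))) R) :=
    fun z hz => by rwa [hK, hKeq] at hz
  -- the contact is off the level, hence off the pinning set
  have hxS : x ∉ pinSetA G SF P w₀ R K := fun h => by
    have h1 := pinSetA_subset_winLevel (w₀ := w₀) (R := R) SF P h
    rw [hKeq] at h1
    exact ((mem_outerBoundary_win_iff G ψ).1 (hx' x hx)).2.1 ((mem_Win G ψ).1 h1).2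
  -- wired regions miss the pinning set
  have hreg : ∀ x₀ ∈ K, IsNear G ψ (lo - (j : Site 2)) (hi + (j : Site 2)) P w₀ R x₀ → ∀ v ∈ ctReg G SF P w₀ R x₀, v ∉ pinSetA G SF P w₀ R K :=
    fun x₀ hx₀ hnear v hv => not_mem_pinSetA_of_mem_ctReg SF hlip hq hstep hw2 hdD hbelow habove hx₀ (hx' x₀ hx₀) hnear hv
  intro hw
  rcases mem_kitSeed_cases _ he with rfl | hE | ⟨v, hv, u, hu, hvu, rfl⟩
  · exact hxS (hw.1 x (Sym2.mem_mk_left _ _))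
  · -- an edge inside the region
    rw [mem_edgesIn_iff] at hE
    induction e using Sym2.ind with
    | h a b =>
      have ha := hE.2 a (Sym2.mem_mk_left a b); have hb := hE.2 b (Sym2.mem_mk_right a b)
      have haT := hw.1 a (Sym2.mem_mk_left a b)
      have hab : G.Adj a b := (SimpleGraph.mem_edgeSet (G := G)).1 hE.1
      simp only [apronGeomA] at ha hb
      split_ifs at ha hb with hnear habs
      · exact hreg x hx hnear a ha haT
      · obtain ⟨h0K, h0near, -⟩ := mem_hosts.1 (host_mem habs)
        exact hreg _ h0K h0near a ha haT
      · rw [Finset.mem_singleton] at ha hb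
        exact hab.ne (ha.trans hb.symm)
  · -- a rung `v — u`
    have hvT : v ∈ (↑(pinSetA G SF P w₀ R K) : Set V) := hw.1 v (Sym2.mem_mk_left _ _)
    rw [Finset.mem_coe] at hvT
    simp only [apronGeomA] at hv hu
    split_ifs at hv hu with hnear habs
    · exact hreg x hx hnear v hv hvT
    · obtain ⟨h0K, h0near, -⟩ := mem_hosts.1 (host_mem habs)
      exact hreg _ h0K h0near v hv hvT
    · rw [Finset.mem_singleton] at hv hu
      exact hvu.ne (hv.trans hu.symm)

end Facts

end Skelφ

end Summit.CriticalPhenomena.PercolationContinuityZ3.Theorems.Transplant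

end
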